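import Literature.AlgebraicGeometry.Resolution.StrictTransformIsBlowup
import HarnessLib

/-!
# `IdealSheafData.comap` along an affine morphism is checked on the charts `t⁻¹U`

OURS · L1 W4.5b · EL♮(3) `stmt-ResolutionOfSingularities-20148` · J1c (β) scheme plumbing (brick B1 of DESIGN v2) · counted 0 (res-type-027 g16).
For an affine morphism `t : X ⟶ X'` (e.g. the closed immersion `Wₙ ↪ Wₙ₊₁`) the preimages `t⁻¹U` of the affine opens `U ⊆ X'` are an
affine open cover of `X`, so an identity `C.comap t = K` of ideal sheaves holds as soon as it holds chartwise, where the chart value of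
`C.comap t` on `t⁻¹U` is the extended ideal `C(U)·Γ(X, t⁻¹U)` (tree `Resolution.ideal_comap_eq_map_of_le`, Görtz–Wedhorn I Ex. 4.36).
[cite: GortzWedhorn2020, Example 4.36 (p. 139)]
-/

noncomputable section

open CategoryTheory AlgebraicGeometry TopologicalSpace
open Literature.AlgebraicGeometry.Resolution

namespace Summit.ResolutionOfSingularities.ResolutionOfSingularities.Cruxes.EquisingularLiftNat.Sections

/-- The charts `t⁻¹U`, `U` affine in `X'`, cover `X`. [folklore] -/
theorem iSup_chart_eq_top {X X' : Scheme.{0}} (t : X ⟶ X') [IsAffineHom t] :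
    ⨆ U : X'.affineOpens, ((⟨t ⁻¹ᵁ (U : X'.Opens), U.2.preimage t⟩ : X.affineOpens) : X.Opens) = ⊤ := by
  change ⨆ U : X'.affineOpens, t ⁻¹ᵁ (U : X'.Opens) = ⊤
  rw [← Scheme.Hom.preimage_iSup, iSup_affineOpens_eq_top, Scheme.Hom.preimage_top]

/-- **Chart formula.** `(C.comap t)(t⁻¹U) = C(U)·Γ(X, t⁻¹U)`. [cite: GortzWedhorn2020, Example 4.36 (p. 139)] -/
theorem comap_ideal_chart {X X' : Scheme.{0}} (t : X ⟶ X') [IsAffineHom t] (C : X'.IdealSheafData) (U : X'.affineOpens) :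
    (C.comap t).ideal (⟨t ⁻¹ᵁ (U : X'.Opens), U.2.preimage t⟩ : X.affineOpens) = (C.ideal U).map (t.appLE U (⟨t ⁻¹ᵁ (U : X'.Opens), U.2.preimage t⟩ : X.affineOpens) le_rfl).hom :=
  ideal_comap_eq_map_of_le t C U (⟨t ⁻¹ᵁ (U : X'.Opens), U.2.preimage t⟩ : X.affineOpens) le_rfl

/-- **`comap` is checked on charts.** If `C(U)·Γ(X, t⁻¹U) = K(t⁻¹U)` for every affine open `U ⊆ X'`, then `C.comap t = K`
(Mathlib `IdealSheafData.ext_of_iSup_eq_top`). [folklore] -/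
theorem comap_eq_of_forall_chart {X X' : Scheme.{0}} (t : X ⟶ X') [IsAffineHom t] (C : X'.IdealSheafData) (K : X.IdealSheafData)
    (h : ∀ U : X'.affineOpens, (C.ideal U).map (t.appLE U (⟨t ⁻¹ᵁ (U : X'.Opens), U.2.preimage t⟩ : X.affineOpens) le_rfl).hom = K.ideal (⟨t ⁻¹ᵁ (U : X'.Opens), U.2.preimage t⟩ : X.affineOpens)) :
    C.comap t = K :=
  Scheme.IdealSheafData.ext_of_iSup_eq_top
    (fun U : X'.affineOpens => (⟨t ⁻¹ᵁ (U : X'.Opens), U.2.preimage t⟩ : X.affineOpens)) (iSup_chart_eq_top t)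
    fun U => by rw [comap_ideal_chart, h]

/-- For a quasi-compact `jn : Yₙ ⟶ X` (e.g. a closed immersion), `K = jn.ker` has chart values `ker (jn.app (t⁻¹U))`
(Mathlib `Scheme.Hom.ker_apply`). [folklore] -/
theorem ker_ideal_chart {X X' Yn : Scheme.{0}} (t : X ⟶ X') [IsAffineHom t] (jn : Yn ⟶ X) [QuasiCompact jn] (U : X'.affineOpens) :
    jn.ker.ideal (⟨t ⁻¹ᵁ (U : X'.Opens), U.2.preimage t⟩ : X.affineOpens) = RingHom.ker (jn.app (t ⁻¹ᵁ (U : X'.Opens))).hom :=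
  Scheme.Hom.ker_apply jn (⟨t ⁻¹ᵁ (U : X'.Opens), U.2.preimage t⟩ : X.affineOpens)

end Summit.ResolutionOfSingularities.ResolutionOfSingularities.Cruxes.EquisingularLiftNat.Sections

end
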